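/-
PORT (pub-hodgecm2, COR-CM cell; TRANSPOSITION surge item (v), seat prover-pub-hodgecm2-tr-prover-5-0, 2026-08-21) of the
stage-1 package file `HodgeCMPerL/HodgeCM/Prior/Perl34.lean` (pub-hodgecm HOME/lean, bytes of record md5 a2455d388f0d, 1862 lines),
PART 2 of 2 = its lines 343–690: the PROOFS of [PerL] v5 Prop 3.6 (`Perl34.TorusData.C1_prop36`, isolation) and Thm 3.7
(`Perl34.IsolationSetting.C2_thm37`, `C2_S12_eq_S34`: the two spans coincide) over the abstract interface of part 1
(`Perl34IsolationSetting.lean`).  Declarations and proofs VERBATIM (field-, degree-, frame- and sign-table-free); edits: provenance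
header, `import` of part 1, outer namespace token `HodgeCM.Prior.Perl34File` ↦ `Summit.HodgeConjecture.CorCM.Prior.Perl34File`, and three linter fixes for the tree's
0-warning policy (deprecated `ContinuousLinearMap.mul_apply`∕`one_apply` in `R_inv_apply`∕`R_apply_inv` ↦ `rfl`; `push_neg` ↦ `push Not`), plus the
package's file-local notation `⟪x, y⟫ := @inner ℂ _ _ x y` replaced by Mathlib's scoped `⟪x, y⟫_ℂ` (the identical term; avoids the tree's
`declares notation` review lint).  The same port was prepared independently by prover-pub-hodgecm2-b09-g14-0 (acting tr-prover-5 until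
13:20Z, HOME/INBOX l.3766–3798; part 1 of record p274312 is b09's filing); the two byte-sets agree outside headers.
Consumer: `CorCM/B01/Transposition/Item5IsolationSpansHolds.lean` (item (v) of rfwf v3 §4.2, tex ll.253–258: discharges
`Transposition.IsolationSpans.SpansCoincide` for every datum coming from an isolation setting).  FRAMING: HC_CM is NOT proved; the
theorems here are about abstract Hilbert-space data and assert nothing about any model.
-/
import Summits.HodgeConjecture.CorCM.Prior.Perl34IsolationSetting

/-!
# Prior-program stockroom file `Hodge_WRankFourWeilFacesY1_C2Thm37` — part 2: C1 = Prop 3.6 and C2 = Thm 3.7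

Imported from the 2001 program: `summits/hodge-w-rank-four-weil-faces/free/y1/lean/perl34/S3/C2_Thm37.lean` (commit a463a4c8cc18),
free `y1` of summit `hodge-w-rank-four-weil-faces`; prior STATUS `-`; imported 2026-08-13 (stockroom
`reserve/prior-2001/Prior/HodgeConjecture/HodgeConjecture/Hodge_WRankFourWeilFacesY1_C2Thm37.lean`).
Mechanical changes only: provenance header, whole body wrapped in the namespace below (original namespaces nested
inside). Proofs untouched.
-/

namespace Summit.HodgeConjecture.CorCM.Prior.Perl34File

/-! # C1 = Proposition 3.6 (prop:isol, [PerL] v5 ll. 397–439)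

Proof section over the VERBATIM frozen interface above (byte-identical prefix =
IsolationSetting.lean @2def0917; verified by `cmp` in S3/README.md).  Hunt items
exhibited as named lemmas:
* hunt (ii) — `TorusData.hunt_ii_L2w_le_closure_Espan`: the heart of Prop 3.6 is
  Φ-FREE (the approximating subspace 𝓔 and the inclusion L²_w ⊆ closure 𝓔 are fixed
  before any Φ is chosen); `C1_prop36` then quantifies ∀ Φ OUTSIDE, per fixed Φ,
  with no uniformity in Φ anywhere ("per FIXED Phi; no forall/exists slip",
  REVIEW.md hunt (ii)).
* hunt (v), compact-Fourier half — `IsolationCore.hunt_v_closed_invariant_hilbert_sum`: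
  closed invariant M = closure(⨆ᵢ (M ⊓ σ̂ᵢ)) is DERIVED from e_σ̂ + completeness
  (plan amendment A#8: demoted from field to lemma), with no dominated-convergence
  or Fatou step — only projection algebra, `Submodule.iSup_induction`, and
  closure minimality.
-/

namespace Perl34

open Submodule Set

open scoped InnerProductSpace

variable {H HG CG G SK SigIdx SigIdxG : Type*}
variable [NormedAddCommGroup H] [InnerProductSpace ℂ H] [CompleteSpace H]
variable [NormedAddCommGroup HG] [InnerProductSpace ℂ HG] [CompleteSpace HG]
variable [NormedAddCommGroup CG] [NormedSpace ℂ CG]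
variable [Group G] [TopologicalSpace G] [TopologicalSpace SK]

namespace IsolationCore

variable (C : IsolationCore H HG CG G SK SigIdx SigIdxG)

/-- `R g⁻¹` inverts `R g` (from the monoid-hom laws). -/
lemma R_inv_apply (g : G) (v : H) : C.R g⁻¹ (C.R g v) = v := by
  have h : C.R g⁻¹ * C.R g = 1 := by rw [← map_mul, inv_mul_cancel, map_one]
  calc C.R g⁻¹ (C.R g v) = (C.R g⁻¹ * C.R g) v := rfl
    _ = v := by rw [h]; rfl

/-- `R g` inverts `R g⁻¹`. -/
lemma R_apply_inv (g : G) (v : H) : C.R g (C.R g⁻¹ v) = v := by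
  have h : C.R g * C.R g⁻¹ = 1 := by rw [← map_mul, mul_inv_cancel, map_one]
  calc C.R g (C.R g⁻¹ v) = (C.R g * C.R g⁻¹) v := rfl
    _ = v := by rw [h]; rfl

/-- Unitarity transfer: ⟪R g⁻¹ u, v⟫_ℂ = ⟪u, R g v⟫_ℂ. -/
lemma inner_R_inv (g : G) (u v : H) : ⟪C.R g⁻¹ u, v⟫_ℂ = ⟪u, C.R g v⟫_ℂ := by
  have h := C.R_unitary g (C.R g⁻¹ u) v
  rw [C.R_apply_inv g u] at h
  exact h.symm

/-- The orthogonal complement of an R-invariant subspace is R-invariant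
(blind template Remark 2.4, at the abstract level: unitarity + group inverses). -/
lemma orthogonal_invariant {M : Submodule ℂ H} (hM : C.Invariant M) :
    C.Invariant Mᗮ := by
  intro g v hv
  rw [Submodule.mem_orthogonal] at hv ⊢
  intro u hu
  rw [← C.inner_R_inv g u v]
  exact hv _ (hM g⁻¹ u hu)

/-- Nonzero-projection transfer: if e_σ̂ v ≠ 0 for some v in a closed invariant M,
then M ⊓ σ̂ ≠ ⊥. -/
lemma inf_ne_bot_of_eσ_ne_zero {M : Submodule ℂ H} (hMc : IsClosed (M : Set H))
    (hMi : C.Invariant M) {i : SigIdx} {v : H} (hv : v ∈ M) (h0 : C.eσ i v ≠ 0) :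
    M ⊓ C.hatσ i ≠ ⊥ := by
  intro hbot
  have hmem : C.eσ i v ∈ M ⊓ C.hatσ i :=
    ⟨C.AX9_espectral M hMc hMi i v hv, C.eσ_mem i v⟩
  rw [hbot, Submodule.mem_bot] at hmem
  exact h0 hmem

/-- **hunt (v), compact-Fourier half** ([PerL] ll. 435–436; plan amendment A#8):
a closed R-invariant subspace is the Hilbert sum of its intersections with the
isotypic components — DERIVED from `eσ` + `hatσ_complete`, not a field.  No
dominated convergence, no Fatou: only projection algebra and closure minimality
(the blind template's checkpoint 8/10 discipline). -/
theorem hunt_v_closed_invariant_hilbert_sum (M : Submodule ℂ H)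
    (hMc : IsClosed (M : Set H)) (hMi : C.Invariant M) :
    M = (⨆ i, M ⊓ C.hatσ i).topologicalClosure := by
  set M₀ := (⨆ i, M ⊓ C.hatσ i).topologicalClosure with hM₀
  have hM₀le : M₀ ≤ M :=
    Submodule.topologicalClosure_minimal _ (iSup_le fun i => inf_le_left) hMc
  refine le_antisymm ?_ hM₀le
  intro v hv
  haveI : CompleteSpace M₀ := (Submodule.isClosed_topologicalClosure _).completeSpace_coe
  set u := v - M₀.starProjection v with hu
  have hproj : M₀.starProjection v ∈ M₀ := M₀.starProjection_apply_mem v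
  have huM : u ∈ M := M.sub_mem hv (hM₀le hproj)
  have huO : u ∈ M₀ᗮ := Submodule.sub_starProjection_mem_orthogonal (K := M₀) v
  have heσ : ∀ i, C.eσ i u = 0 := by
    intro i
    have h1 : C.eσ i u ∈ M₀ := Submodule.le_topologicalClosure _
      (Submodule.mem_iSup_of_mem i ⟨C.AX9_espectral M hMc hMi i u huM, C.eσ_mem i u⟩)
    have h2 : ⟪C.eσ i u, u⟫_ℂ = 0 := (Submodule.mem_orthogonal _ u).1 huO _ h1
    have h4 : C.eσ i (C.eσ i u) = C.eσ i u := C.eσ_fix i _ (C.eσ_mem i u)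
    have h3 : ⟪C.eσ i u, C.eσ i u⟫_ℂ = 0 := by
      have h5 := C.eσ_selfAdjoint i (C.eσ i u) u
      rw [h4] at h5
      rw [← h5]
      exact h2
    exact inner_self_eq_zero.1 h3
  have hall : ⟪u, u⟫_ℂ = 0 := by
    have hsub : ((⨆ i, C.hatσ i : Submodule ℂ H) : Set H) ⊆ {x : H | ⟪x, u⟫_ℂ = 0} := by
      intro x hx
      refine Submodule.iSup_induction (motive := fun y => ⟪y, u⟫_ℂ = 0) C.hatσ hx ?_ ?_ ?_
      · intro j y hy
        calc ⟪y, u⟫_ℂ = ⟪C.eσ j y, u⟫_ℂ := by rw [C.eσ_fix j y hy]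
          _ = ⟪y, C.eσ j u⟫_ℂ := C.eσ_selfAdjoint j y u
          _ = 0 := by rw [heσ j, inner_zero_right]
      · exact inner_zero_left _
      · intro a b ha hb; rw [inner_add_left, ha, hb, add_zero]
    have hZ : IsClosed {x : H | ⟪x, u⟫_ℂ = 0} :=
      isClosed_eq (Continuous.inner continuous_id continuous_const) continuous_const
    have hcl := closure_minimal hsub hZ
    have hu_mem : u ∈ closure ((⨆ i, C.hatσ i : Submodule ℂ H) : Set H) := by
      rw [← Submodule.topologicalClosure_coe, C.hatσ_complete]
      exact Submodule.mem_top
    exact hcl hu_mem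
  have hu0 : u = 0 := inner_self_eq_zero.1 hall
  have hveq : v = M₀.starProjection v := by
    have := sub_eq_zero.1 (hu ▸ hu0)
    exact this
  rw [hveq]; exact hproj

end IsolationCore

namespace TorusData

variable {C : IsolationCore H HG CG G SK SigIdx SigIdxG} (D : TorusData C)

/-- S₁₂ is closed in L²([G_U]) (from its definition as a topological closure). -/
lemma S12_isClosed : IsClosed (D.S12 : Set HG) := by
  rw [D.S12_def]; exact Submodule.isClosed_topologicalClosure _

/-- 𝓔 = span{E^χ_f} is R-invariant ([PerL] ll. 410–411 via `AX12_E_transl`). -/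
lemma Espan_invariant : C.Invariant D.Espan := by
  intro g v hv
  have h : Submodule.map (C.R g).toLinearMap D.Espan ≤ D.Espan := by
    unfold TorusData.Espan
    rw [Submodule.map_span]
    refine Submodule.span_le.2 ?_
    rintro _ ⟨_, ⟨χ, f, rfl⟩, rfl⟩
    exact Submodule.subset_span ⟨χ, D.ETransl g χ f, by simpa using D.AX12_E_transl g χ f⟩
  exact h (Submodule.mem_map_of_mem hv)

/-- P_w kills 𝓔ᗮ (the composite field `AX8_annihilation` applied to the spanning
vectors; [PerL] Step 2, ll. 423–434). -/
lemma Pw_eq_zero_of_mem_Espan_orth {v : H} (hv : v ∈ D.Espanᗮ) : D.Pw v = 0 :=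
  D.AX8_annihilation v fun χ f =>
    (Submodule.mem_orthogonal _ v).1 hv _ (Submodule.subset_span ⟨χ, f, rfl⟩)

/-- For a w-occurring σ̂: 𝓔ᗮ ⊓ σ̂ = ⊥ — the contradiction of [PerL] ll. 434–437:
a nonzero vector there would be P_w-fixed (`AX9_w_vector`) yet P_w-killed
(`AX8_annihilation`). -/
lemma Espan_orth_inf_eq_bot (i : SigIdx) (hi : D.wOccurs i) :
    D.Espanᗮ ⊓ C.hatσ i = ⊥ := by
  by_contra hne
  obtain ⟨z, hz, hz0, hzw⟩ := D.AX9_w_vector D.Espanᗮ (Submodule.isClosed_orthogonal _)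
    (C.orthogonal_invariant D.Espan_invariant) i hi hne
  exact hz0 (by rw [← hzw, D.Pw_eq_zero_of_mem_Espan_orth hz.1])

/-- **hunt (ii), the Φ-free heart of Prop 3.6** ([PerL] Step 2 conclusion,
ll. 434–438): L²_w ⊆ closure 𝓔.  No Φ appears: the approximating subspace and
the inclusion are fixed BEFORE any Φ is chosen, so `C1_prop36`'s ∀Φ quantifier
commutes with nothing — "per FIXED Φ; no forall/exists slip" (REVIEW.md (ii)). -/
theorem hunt_ii_L2w_le_closure_Espan : D.L2w ≤ D.Espan.topologicalClosure := by
  rw [← Submodule.orthogonal_orthogonal_eq_closure]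
  unfold TorusData.L2w
  refine Submodule.topologicalClosure_minimal _ (iSup_le ?_) (Submodule.isClosed_orthogonal _)
  rintro ⟨i, hi⟩ s hs
  rw [Submodule.mem_orthogonal]
  intro n hn
  have h0 : C.eσ i n = 0 := by
    by_contra hne
    exact absurd (D.Espan_orth_inf_eq_bot i hi)
      (C.inf_ne_bot_of_eσ_ne_zero (Submodule.isClosed_orthogonal _)
        (C.orthogonal_invariant D.Espan_invariant) hn hne)
  calc ⟪n, s⟫_ℂ = ⟪n, C.eσ i s⟫_ℂ := by rw [C.eσ_fix i s hs]
    _ = ⟪C.eσ i n, s⟫_ℂ := (C.eσ_selfAdjoint i n s).symm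
    _ = 0 := by rw [h0, inner_zero_left]

/-- **C1 = Proposition 3.6 (prop:isol, [PerL] ll. 397–439).**  Under H_chars
(ll. 398–400, the hypothesis `hch`): for every Φ ∈ 𝒮^κ, 𝒯_Φ(L²_w) ⊆ S₁₂.
The ∀Φ is outermost after the Φ-free `hunt_ii_L2w_le_closure_Espan`; the proof
is per fixed Φ with no uniformity in Φ (hunt (ii)). -/
theorem C1_prop36 (hch : ∀ χ : D.X, D.allowed χ) (Φ : SK) :
    ∀ v ∈ D.L2w, C.TΦ Φ v ∈ D.S12 := by
  intro v hv
  have hgen : ∀ χ f, C.TΦ Φ (D.E χ f) ∈ D.S12 := by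
    intro χ f
    have h2 : (Submodule.span ℂ (Set.range fun h : G =>
        C.inclCG (D.ϑc χ (C.omg h Φ)))).topologicalClosure ≤ D.S12 := by
      rw [D.S12_def]
      refine Submodule.topologicalClosure_mono (Submodule.span_mono ?_)
      rintro _ ⟨h, rfl⟩
      exact ⟨χ, hch χ, C.omg h Φ, rfl⟩
    exact h2 (D.AX12_unfold_lift Φ χ f)
  have hmap : ∀ u ∈ D.Espan, C.TΦ Φ u ∈ D.S12 := by
    intro u hu
    have hle : D.Espan ≤ D.S12.comap (C.TΦ Φ).toLinearMap := by
      unfold TorusData.Espan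
      refine Submodule.span_le.2 ?_
      rintro _ ⟨χ, f, rfl⟩
      exact hgen χ f
    exact Submodule.mem_comap.1 (hle hu)
  have hvE : v ∈ D.Espan.topologicalClosure := D.hunt_ii_L2w_le_closure_Espan hv
  have hv' : v ∈ closure (D.Espan : Set H) := by
    rw [← Submodule.topologicalClosure_coe]; exact hvE
  have himg : C.TΦ Φ v ∈ closure ((C.TΦ Φ) '' (D.Espan : Set H)) :=
    image_closure_subset_closure_image (C.TΦ Φ).continuous ⟨v, hv', rfl⟩
  have hsub : ((C.TΦ Φ) '' (D.Espan : Set H)) ⊆ (D.S12 : Set HG) := by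
    rintro _ ⟨u, hu, rfl⟩; exact hmap u hu
  have hfin := closure_mono hsub himg
  rwa [D.S12_isClosed.closure_eq] at hfin

end TorusData

end Perl34

/-! # C2 = Theorem 3.7 (thm:R, [PerL] v5 ll. 440–458)

Proof section over the verbatim prefix above (= C1_Prop36.lean byte-identical,
which itself extends the frozen IsolationSetting.lean @2def0917; `cmp`-verified in
S3/README.md).  Hunt item (i): S₁₂ = S₃₄ = closure(Σ_Φ 𝒯_Φ(L²([U(W)]))) with the
closure and span as Mathlib `Submodule.topologicalClosure` / `Submodule.span` /
`iSup` of ranges, NO closure/span interchange lemma anywhere: Claim 1 places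
generators in the closed `SfullC` by the mollification field + `closure_mono`;
Claim 2 pushes 𝒯_Φ through `closure (⨆ σ̂)` by CONTINUITY (`image_closure_subset_
closure_image`) and `Submodule.iSup_induction` — [PerL]'s good/bad Hilbert-sum
split (ll. 449–452) is subsumed: no orthogonal series, no term-vanishing-on-a-
dense-subspace argument is needed at this abstraction (the derived hunt-(v) lemma
records the decomposition fact itself).  Both halves of H_occ are consumed
independently (w-half for S_full ⊆ S₁₂, w′-half for S_full ⊆ S₃₄) exactly as in
the blind template Remark 5.1. -/

namespace Perl34

open Submodule Set

open scoped InnerProductSpace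

variable {H HG CG G SK SigIdx SigIdxG : Type*}
variable [NormedAddCommGroup H] [InnerProductSpace ℂ H] [CompleteSpace H]
variable [NormedAddCommGroup HG] [InnerProductSpace ℂ HG] [CompleteSpace HG]
variable [NormedAddCommGroup CG] [NormedSpace ℂ CG]
variable [Group G] [TopologicalSpace G] [TopologicalSpace SK]

namespace IsolationCore

variable (C : IsolationCore H HG CG G SK SigIdx SigIdxG)

/-- closure(Σ_{Φ ∈ 𝒮^κ} 𝒯_Φ(L²([U(W)]))) over the core alone ([PerL] l. 444);
`IsolationSetting.Sfull` is definitionally this at `C = S.core`. -/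
def SfullC : Submodule ℂ HG :=
  (⨆ Φ : SK, LinearMap.range (C.TΦ Φ).toLinearMap).topologicalClosure

/-- (no docstring in the 2001 source) -/
lemma SfullC_isClosed : IsClosed (C.SfullC : Set HG) :=
  Submodule.isClosed_topologicalClosure _

end IsolationCore

namespace TorusData

variable {C : IsolationCore H HG CG G SK SigIdx SigIdxG} (D : TorusData C)

/-- **Claim 1 of Thm 3.7** ([PerL] ll. 453–456): S₁₂ ⊆ closure(Σ_Φ 𝒯_Φ(L²)).
Each generator ϑ_{T,χ}(Φ) is an L²-limit of 𝒯_Φ(E^χ_{f_n}) (`AX12_molly`), each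
of which lies in range 𝒯_Φ ⊆ SfullC; SfullC is closed.  H_occ is NOT consumed
(blind template: "(dagger) is NOT needed here").  Hunt (i): only
`topologicalClosure_minimal`, `span_le`, `closure_mono` — no interchange. -/
theorem S12_le_SfullC : D.S12 ≤ C.SfullC := by
  rw [D.S12_def]
  refine Submodule.topologicalClosure_minimal _ (Submodule.span_le.2 ?_) C.SfullC_isClosed
  rintro _ ⟨χ, hχ, Φ, rfl⟩
  have h2 : (Set.range fun f : D.TestFn => (C.TΦ Φ) (D.E χ f)) ⊆ (C.SfullC : Set HG) := by
    rintro _ ⟨f, rfl⟩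
    exact Submodule.le_topologicalClosure _
      (Submodule.mem_iSup_of_mem Φ (LinearMap.mem_range_self _ _))
  have h3 := closure_mono h2 (D.AX12_molly χ Φ)
  rwa [C.SfullC_isClosed.closure_eq] at h3

/-- **Claim 2 of Thm 3.7** ([PerL] ll. 449–453): closure(Σ_Φ 𝒯_Φ(L²)) ⊆ S₁₂,
from C1 + H_chars + (this side's half of) H_occ.  For v in the dense algebraic
sum ⨆ σ̂: by `iSup_induction`, per σ̂ either 𝒯_Φ|_σ̂ = 0 or H_occ puts σ̂ inside
L²_w and C1 applies; the general v is reached by CONTINUITY of 𝒯_Φ on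
closure(⨆ σ̂) = L² — no orthogonal series ([PerL]'s L²_good/L²_bad split is
subsumed; hunt (i): no interchange, hunt (v): no Fatou/dominated step). -/
theorem SfullC_le_S12 (hch : ∀ χ : D.X, D.allowed χ)
    (hocc : ∀ (Φ : SK) i, (∃ v ∈ C.hatσ i, C.TΦ Φ v ≠ 0) → D.wOccurs i) :
    C.SfullC ≤ D.S12 := by
  refine Submodule.topologicalClosure_minimal _ (iSup_le ?_) D.S12_isClosed
  intro Φ u hu
  obtain ⟨v, rfl⟩ := LinearMap.mem_range.1 hu
  have hv : v ∈ ((⨆ i, C.hatσ i).topologicalClosure : Submodule ℂ H) := by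
    rw [C.hatσ_complete]; exact Submodule.mem_top
  have hstep : ∀ x ∈ (⨆ i, C.hatσ i : Submodule ℂ H), C.TΦ Φ x ∈ D.S12 := by
    intro x hx
    refine Submodule.iSup_induction (motive := fun y => C.TΦ Φ y ∈ D.S12) C.hatσ hx ?_ ?_ ?_
    · intro i y hy
      by_cases hz : ∀ z ∈ C.hatσ i, C.TΦ Φ z = 0
      · rw [hz y hy]; exact D.S12.zero_mem
      · push Not at hz
        have hyL : y ∈ D.L2w := Submodule.le_topologicalClosure _
          (Submodule.mem_iSup_of_mem ⟨i, hocc Φ i hz⟩ hy)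
        exact D.C1_prop36 hch Φ y hyL
    · rw [map_zero]; exact D.S12.zero_mem
    · intro a b ha hb; rw [map_add]; exact D.S12.add_mem ha hb
  have hv' : v ∈ closure ((⨆ i, C.hatσ i : Submodule ℂ H) : Set H) := by
    rw [← Submodule.topologicalClosure_coe]; exact hv
  have himg : C.TΦ Φ v ∈ closure ((C.TΦ Φ) '' ((⨆ i, C.hatσ i : Submodule ℂ H) : Set H)) :=
    image_closure_subset_closure_image (C.TΦ Φ).continuous ⟨v, hv', rfl⟩
  have hsub : (C.TΦ Φ) '' ((⨆ i, C.hatσ i : Submodule ℂ H) : Set H) ⊆ (D.S12 : Set HG) := by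
    rintro _ ⟨x, hx, rfl⟩; exact hstep x hx
  have hfin := closure_mono hsub himg
  rwa [D.S12_isClosed.closure_eq] at hfin

end TorusData

namespace IsolationSetting

variable (S : IsolationSetting H HG CG G SK SigIdx SigIdxG)

/-- (no docstring in the 2001 source) -/
lemma Sfull_eq_SfullC : S.Sfull = S.core.SfullC := rfl

/-- **C2 = Theorem 3.7 (thm:R, [PerL] ll. 440–458): the two spans coincide.**
Under H_chars (both sides) and H_occ (the (dagger), ll. 441–443):
S₁₂ = S₃₄ = closure(Σ_{Φ ∈ 𝒮^κ} 𝒯_Φ(L²([U(W)]))).  The two H_occ halves are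
consumed independently, one per side (blind template Remark 5.1). -/
theorem C2_thm37 : S.t12.S12 = S.Sfull ∧ S.t34.S12 = S.Sfull := by
  have h12 : S.t12.S12 = S.core.SfullC :=
    le_antisymm S.t12.S12_le_SfullC (S.t12.SfullC_le_S12 S.H_chars12 S.H_occ12)
  have h34 : S.t34.S12 = S.core.SfullC :=
    le_antisymm S.t34.S12_le_SfullC (S.t34.SfullC_le_S12 S.H_chars34 S.H_occ34)
  rw [Sfull_eq_SfullC]
  exact ⟨h12, h34⟩

/-- The headline equality S₁₂ = S₃₄ ([PerL] l. 444, first equality). -/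
theorem C2_S12_eq_S34 : S.t12.S12 = S.t34.S12 := by
  rw [(C2_thm37 S).1, (C2_thm37 S).2]

end IsolationSetting

end Perl34

end Summit.HodgeConjecture.CorCM.Prior.Perl34File
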